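import Literature.NumberTheory.EllipticCurves.NewformOpenImage
import Literature.GroupTheory.Index.PadicGL2Congruence
import HarnessLib

/-!
# Open image: the `ℓ`-adic successive-approximation engine (proofs file, theorems only)

Sibling proofs file of `NewformOpenImage.lean` (no definitions, no named facts): the
topological-group tail of the open-image theorem `momose_isOpen_range_galoisRep` (Ribet 1985,
§3; Ribet 1977, Thm. (5.7); Serre).  Every proof of an open-image statement for a compact
`ℓ`-adic matrix group ends the same way: once the image is known to fill one level
`Γ(ℓˢ)/Γ(ℓ^{s+1}) ≅ M₂(𝔽_ℓ)` of the congruence filtration of `GL₂(ℤ_ℓ)` (the output of the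
Lie-algebra computation, not formalised here), successive approximation (Serre, *Abelian
`ℓ`-adic representations*, IV-23, Lemma 3) shows that it contains `Γ(ℓˢ)`, hence is open in
`GL₂(ℚ_ℓ)`.  This file proves that tail, for every prime `ℓ` (including `2`) from any level
`s ≥ 2`, in the carriers of `Literature/GroupTheory/Index/PadicGL2Congruence.lean`
(`GL2.congruenceSubgroup s = Γ(ℓˢ) = ker (GL₂(ℤ_ℓ) → GL₂(ℤ/ℓˢ))`):

* `OpenImage.exists_one_add_pow_eq` — `(1 + X)ⁿ = 1 + n X + X² b` in any ring;
  `OpenImage.pow_prime_map_toZModPow` — `(1 + ℓᵐ a)^ℓ ≡ 1 + ℓ^{m+1} a (mod ℓ^{m+2})`, `m ≥ 2`.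
* `OpenImage.congruenceSubgroup_le_of_isClosed` — **successive approximation**: a closed
  subgroup `G ≤ GL₂(ℤ_ℓ)` meeting every class of `Γ(ℓˢ)/Γ(ℓ^{s+1})`, `s ≥ 2`, contains `Γ(ℓˢ)`.
* `OpenImage.exists_map_eq_of_mem_box`, `OpenImage.isOpen_of_map_congruenceSubgroup_le` — the
  box `‖g − 1‖ ≤ ℓ^{-m}` of `GL₂(ℚ_ℓ)` lies in `ι(Γ(ℓᵐ))` (`ι : GL₂(ℤ_ℓ) → GL₂(ℚ_ℓ)`), so a
  subgroup of `GL₂(ℚ_ℓ)` containing `ι(Γ(ℓᵐ))`, `m ≥ 1`, is open.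
* `OpenImage.isOpen_range_of_meets` — for a continuous `ρ : Γ_ℚ → GL₂(ℚ_ℓ)` whose image meets
  every class of `Γ(ℓˢ)/Γ(ℓ^{s+1})` for one `s ≥ 2`, `ρ(Γ_ℚ)` is open (compact image ⇒ closed
  trace on `GL₂(ℤ_ℓ)` ⇒ successive approximation).
* `OpenImage.mem_of_isClosed_of_sl2_meets` — the `SL₂` variant (Serre's own setting): classes
  `1 + ℓˢ a` with `ℓ ∣ tr a` met by determinant-one elements of `G` give
  `SL₂(ℤ_ℓ) ∩ Γ(ℓˢ) ⊆ G`; `OpenImage.map_congruenceSubgroup_le_of_sl2_of_det`,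
  `OpenImage.isOpen_of_sl2_of_det` — together with determinants covering `1 + ℓᶜ ℤ_ℓ` this
  gives `ι(Γ(ℓᶜ)) ⊆ S`, hence openness; `OpenImage.isOpen_range_of_sl2_meets_of_det` — the
  packaged criterion for `ρ` (trace-zero classes at one level `s ≥ 2` via determinant-one image
  elements, e.g. commutators, plus determinants, e.g. `det ρ = χ_ℓ^{k−1}`).
* The graded structure used to feed these hypotheses: `OpenImage.map_mul_of_map_eq`,
  `OpenImage.map_pow_of_map_eq` (the class map at one level is a homomorphism),
  `OpenImage.map_commutator_eq`, `OpenImage.map_commutator_eq_of_map_eq` (**commutators are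
  graded brackets**: `(1 + ℓᵃ x)(1 + ℓᵇ y)(1 + ℓᵃ x)⁻¹(1 + ℓᵇ y)⁻¹ ≡ 1 + ℓ^{a+b} [x, y]
  (mod ℓ^{a+b+1})`, of determinant `1`, `OpenImage.det_commutator_eq_one`), and
  `OpenImage.sl2_meets_of_three` (the classes of `E = e₁₂`, `F = e₂₁`, `H = e₁₁ − e₂₂` at one
  level suffice for all trace-zero classes).

What remains for `momose_isOpen_range_galoisRep_holds` (recorded, not claimed): Ribet 1977,
Thm. (2.3) (the tree's named fact `Ribet1977.thm23_isIrreducible`), (4.1)–(4.4) (no open abelian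
subgroup unless CM; infinite projective image), and the `ℓ`-adic Lie-algebra computation
`𝔤_ℓ = 𝔤𝔩₂` (Ribet 1977, Thm. (5.7), after Serre) producing the full level used here.

## References

* J.-P. Serre, *Abelian ℓ-adic representations and elliptic curves*, Benjamin 1968, Ch. IV,
  §3.4, Lemma 3 (p. IV-23) and its proof (successive approximation in `SL₂(ℤ_ℓ)`).
  [SerreAbelianLadic1968]
* K. A. Ribet, *On ℓ-adic representations attached to modular forms II*, Glasgow Math. J. 27
  (1985) 185–194, §3 (p. 191). [Ribet1985]
* K. A. Ribet, *Galois representations attached to eigenforms with Nebentypus*, LNM 601 (1977),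
  §4 and Thm. (5.7). [Ribet1977Nebentypus]
-/

noncomputable section

open scoped MatrixGroups
open Matrix Filter Topology

namespace Literature.NumberTheory.EllipticCurves.ModularForms

namespace OpenImage

open Literature.GroupTheory.Index

variable {ℓ : ℕ} [Fact ℓ.Prime]

/-! ### Congruences modulo `ℓ^s` in `M₂(ℤ_ℓ)` -/

/-- `ℓ^s x ≡ 0 (mod ℓ^s)`. [folklore] -/
theorem toZModPow_pow_mul (s : ℕ) (x : ℤ_[ℓ]) :
    PadicInt.toZModPow s ((ℓ : ℤ_[ℓ]) ^ s * x) = 0 := by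
  rw [← RingHom.mem_ker, PadicInt.ker_toZModPow]
  exact Ideal.mul_mem_right _ _ (Ideal.mem_span_singleton_self _)

/-- `ℓ^t x ≡ 0 (mod ℓ^s)` for `s ≤ t`. [folklore] -/
theorem toZModPow_pow_mul_of_le {s t : ℕ} (hst : s ≤ t) (x : ℤ_[ℓ]) :
    PadicInt.toZModPow s ((ℓ : ℤ_[ℓ]) ^ t * x) = 0 := by
  rw [← Nat.add_sub_cancel' hst, pow_add, mul_assoc]
  exact toZModPow_pow_mul s _

/-- `ℓ^t • c ≡ 0 (mod ℓ^s)` entrywise, for `s ≤ t`. [folklore] -/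
theorem map_smul_pow_eq_zero {s t : ℕ} (hst : s ≤ t) (c : Matrix (Fin 2) (Fin 2) ℤ_[ℓ]) :
    ((ℓ : ℤ_[ℓ]) ^ t • c).map (PadicInt.toZModPow s) = 0 := by
  ext i j
  simp only [Matrix.map_apply, Matrix.smul_apply, smul_eq_mul, Matrix.zero_apply]
  exact toZModPow_pow_mul_of_le hst _

/-- Two integral matrices have the same reduction modulo `ℓ^s` iff their entries are congruent
modulo `ℓ^s`. [folklore] -/
theorem map_toZModPow_eq_iff (s : ℕ) (A B : Matrix (Fin 2) (Fin 2) ℤ_[ℓ]) :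
    A.map (PadicInt.toZModPow s) = B.map (PadicInt.toZModPow s) ↔
      ∀ i j, (ℓ : ℤ_[ℓ]) ^ s ∣ A i j - B i j := by
  simp only [← Matrix.ext_iff, Matrix.map_apply]
  refine forall_congr' fun i ↦ forall_congr' fun j ↦ ?_
  rw [← sub_eq_zero, ← map_sub, ← RingHom.mem_ker, PadicInt.ker_toZModPow,
    Ideal.mem_span_singleton]

/-- Congruent matrices differ by `ℓ^s • e`. [folklore] -/
theorem exists_eq_add_smul_of_map_eq {s : ℕ} {A B : Matrix (Fin 2) (Fin 2) ℤ_[ℓ]}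
    (h : A.map (PadicInt.toZModPow s) = B.map (PadicInt.toZModPow s)) :
    ∃ e : Matrix (Fin 2) (Fin 2) ℤ_[ℓ], A = B + (ℓ : ℤ_[ℓ]) ^ s • e := by
  rw [map_toZModPow_eq_iff] at h
  have h' : ∀ i j, ∃ c : ℤ_[ℓ], A i j - B i j = (ℓ : ℤ_[ℓ]) ^ s * c := fun i j ↦ h i j
  choose e he using h'
  refine ⟨Matrix.of fun i j ↦ e i j, ?_⟩
  ext i j
  simp only [Matrix.add_apply, Matrix.smul_apply, Matrix.of_apply, smul_eq_mul]
  rw [← he i j]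
  ring

/-- Adding `ℓ^t • e` does not change the reduction modulo `ℓ^s`, `s ≤ t`. [folklore] -/
theorem map_add_smul_pow_eq {s t : ℕ} (hst : s ≤ t) (B e : Matrix (Fin 2) (Fin 2) ℤ_[ℓ]) :
    (B + (ℓ : ℤ_[ℓ]) ^ t • e).map (PadicInt.toZModPow s) = B.map (PadicInt.toZModPow s) := by
  rw [Matrix.map_add (PadicInt.toZModPow s) (map_add _), map_smul_pow_eq_zero hst, add_zero]

/-! ### The `ℓ`-th power map `Γ(ℓ^m) → Γ(ℓ^{m+1})` modulo `ℓ^{m+2}` -/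

/-- `(1 + X)ⁿ = 1 + n • X + X² b` for some `b` (commuting with nothing in particular), in any
ring. [folklore] -/
theorem exists_one_add_pow_eq {R : Type*} [Ring R] (X : R) (n : ℕ) :
    ∃ b : R, (1 + X) ^ n = 1 + n • X + X * X * b := by
  induction n with
  | zero => exact ⟨0, by simp⟩
  | succ n ih =>
    obtain ⟨b, hb⟩ := ih
    refine ⟨n • (1 : R) + b + b * X, ?_⟩
    rw [pow_succ, hb]
    simp only [mul_add, add_mul, mul_one, one_mul, succ_nsmul, smul_mul_assoc, mul_smul_comm,
      mul_assoc]
    abel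

/-- **The `ℓ`-th power map.** For `m ≥ 2` and `a ∈ M₂(ℤ_ℓ)`:
`(1 + ℓᵐ a)^ℓ = 1 + ℓ^{m+1} a + ℓ^{m+2} c` for some `c`. [folklore] -/
theorem exists_one_add_smul_pow_prime_eq {m : ℕ} (hm : 2 ≤ m) (a : Matrix (Fin 2) (Fin 2) ℤ_[ℓ]) :
    ∃ c : Matrix (Fin 2) (Fin 2) ℤ_[ℓ],
      (1 + (ℓ : ℤ_[ℓ]) ^ m • a) ^ ℓ = 1 + (ℓ : ℤ_[ℓ]) ^ (m + 1) • a + (ℓ : ℤ_[ℓ]) ^ (m + 2) • c := by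
  obtain ⟨b, hb⟩ := exists_one_add_pow_eq ((ℓ : ℤ_[ℓ]) ^ m • a) ℓ
  refine ⟨(ℓ : ℤ_[ℓ]) ^ (m - 2) • (a * a * b), ?_⟩
  rw [hb]
  have h1 : ℓ • ((ℓ : ℤ_[ℓ]) ^ m • a) = (ℓ : ℤ_[ℓ]) ^ (m + 1) • a := by
    rw [← Nat.cast_smul_eq_nsmul ℤ_[ℓ], smul_smul, pow_succ, mul_comm]
  have h2 : (ℓ : ℤ_[ℓ]) ^ m • a * ((ℓ : ℤ_[ℓ]) ^ m • a) * b =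
      (ℓ : ℤ_[ℓ]) ^ (m + 2) • ((ℓ : ℤ_[ℓ]) ^ (m - 2) • (a * a * b)) := by
    rw [smul_mul_assoc, smul_mul_assoc, mul_smul_comm, smul_mul_assoc, smul_smul, smul_smul,
      ← pow_add, ← pow_add]
    congr 2
    omega
  rw [h1, h2]

/-- **`(1 + ℓᵐ a)^ℓ ≡ 1 + ℓ^{m+1} a (mod ℓ^{m+2})`** for `m ≥ 2`. [folklore] -/
theorem pow_prime_map_toZModPow {m : ℕ} (hm : 2 ≤ m) (a : Matrix (Fin 2) (Fin 2) ℤ_[ℓ]) :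
    ((1 + (ℓ : ℤ_[ℓ]) ^ m • a) ^ ℓ).map (PadicInt.toZModPow (m + 2)) =
      (1 + (ℓ : ℤ_[ℓ]) ^ (m + 1) • a).map (PadicInt.toZModPow (m + 2)) := by
  obtain ⟨c, hc⟩ := exists_one_add_smul_pow_prime_eq hm a
  rw [hc, map_add_smul_pow_eq le_rfl]

/-- If `g ≡ 1 + ℓˢ a (mod ℓ^{s+1})` with `s ≥ 2` then `g^ℓ ≡ 1 + ℓ^{s+1} a (mod ℓ^{s+2})`.
[folklore] -/
theorem pow_prime_map_toZModPow_of_map_eq {s : ℕ} (hs : 2 ≤ s)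
    {g a : Matrix (Fin 2) (Fin 2) ℤ_[ℓ]}
    (hg : g.map (PadicInt.toZModPow (s + 1)) =
      (1 + (ℓ : ℤ_[ℓ]) ^ s • a).map (PadicInt.toZModPow (s + 1))) :
    (g ^ ℓ).map (PadicInt.toZModPow (s + 2)) =
      (1 + (ℓ : ℤ_[ℓ]) ^ (s + 1) • a).map (PadicInt.toZModPow (s + 2)) := by
  obtain ⟨e, he⟩ := exists_eq_add_smul_of_map_eq hg
  have hge : g = 1 + (ℓ : ℤ_[ℓ]) ^ s • (a + (ℓ : ℤ_[ℓ]) • e) := by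
    rw [he, smul_add, smul_smul, ← pow_succ, add_assoc]
  rw [hge, pow_prime_map_toZModPow hs, smul_add, smul_smul, ← pow_succ, ← add_assoc,
    map_add_smul_pow_eq le_rfl]

/-! ### Successive approximation -/

/-- Reduction modulo `ℓ^s` of an element of `GL₂(ℤ_ℓ)`, entrywise. [folklore] -/
theorem coe_map_toZModPow (s : ℕ) (g : GL (Fin 2) ℤ_[ℓ]) :
    ((Matrix.GeneralLinearGroup.map (PadicInt.toZModPow s) g : GL (Fin 2) (ZMod (ℓ ^ s))) :
        Matrix (Fin 2) (Fin 2) (ZMod (ℓ ^ s))) =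
      (g : Matrix (Fin 2) (Fin 2) ℤ_[ℓ]).map (PadicInt.toZModPow s) := rfl

/-- Membership in `Γ(ℓ^s)` in terms of the reduction of the matrix. [folklore] -/
theorem mem_congruenceSubgroup_iff_map_eq (s : ℕ) (g : GL (Fin 2) ℤ_[ℓ]) :
    g ∈ GL2.congruenceSubgroup (p := ℓ) s ↔
      (g : Matrix (Fin 2) (Fin 2) ℤ_[ℓ]).map (PadicInt.toZModPow s) = 1 := by
  rw [GL2.congruenceSubgroup, MonoidHom.mem_ker, Units.ext_iff, coe_map_toZModPow]
  rfl

/-- An element of `Γ(ℓ^s)` is `1 + ℓ^s a`. [folklore] -/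
theorem exists_eq_one_add_smul_of_mem {s : ℕ} {g : GL (Fin 2) ℤ_[ℓ]}
    (hg : g ∈ GL2.congruenceSubgroup (p := ℓ) s) :
    ∃ a : Matrix (Fin 2) (Fin 2) ℤ_[ℓ], (g : Matrix (Fin 2) (Fin 2) ℤ_[ℓ]) = 1 + (ℓ : ℤ_[ℓ]) ^ s • a := by
  rw [mem_congruenceSubgroup_iff_map_eq] at hg
  have h1 : (g : Matrix (Fin 2) (Fin 2) ℤ_[ℓ]).map (PadicInt.toZModPow s) =
      (1 : Matrix (Fin 2) (Fin 2) ℤ_[ℓ]).map (PadicInt.toZModPow s) := by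
    rw [hg, Matrix.map_one _ (map_zero _) (map_one _)]
  exact exists_eq_add_smul_of_map_eq h1

/-- `1 + ℓ^s a` (`s ≥ 1`) is invertible in `M₂(ℤ_ℓ)`. [folklore] -/
theorem isUnit_one_add_smul {s : ℕ} (hs : 1 ≤ s) (a : Matrix (Fin 2) (Fin 2) ℤ_[ℓ]) :
    IsUnit (1 + (ℓ : ℤ_[ℓ]) ^ s • a) := by
  rw [Matrix.isUnit_iff_isUnit_det, GL2.isUnit_iff_isUnit_toZModPow hs, RingHom.map_det,
    RingHom.mapMatrix_apply, map_add_smul_pow_eq le_rfl,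
    Matrix.map_one _ (map_zero _) (map_one _), det_one]
  exact isUnit_one

/-- The two hypotheses of successive approximation, propagated one level up: if every class of
`Γ(ℓˢ)/Γ(ℓ^{s+1})` meets `G` (`s ≥ 2`), then so does every class of `Γ(ℓ^{s+1})/Γ(ℓ^{s+2})`
(take `ℓ`-th powers). [cite: SerreAbelianLadic1968, Ch. IV §3.4, Lemma 3 (p. IV-23), proof] -/
theorem meets_succ {G : Subgroup (GL (Fin 2) ℤ_[ℓ])} {s : ℕ} (hs : 2 ≤ s)
    (H : ∀ a : Matrix (Fin 2) (Fin 2) ℤ_[ℓ], ∃ g ∈ G,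
      (g : Matrix (Fin 2) (Fin 2) ℤ_[ℓ]).map (PadicInt.toZModPow (s + 1)) =
        (1 + (ℓ : ℤ_[ℓ]) ^ s • a).map (PadicInt.toZModPow (s + 1))) :
    ∀ a : Matrix (Fin 2) (Fin 2) ℤ_[ℓ], ∃ g ∈ G,
      (g : Matrix (Fin 2) (Fin 2) ℤ_[ℓ]).map (PadicInt.toZModPow (s + 1 + 1)) =
        (1 + (ℓ : ℤ_[ℓ]) ^ (s + 1) • a).map (PadicInt.toZModPow (s + 1 + 1)) := by
  intro a
  obtain ⟨g, hgG, hg⟩ := H a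
  refine ⟨g ^ ℓ, G.pow_mem hgG ℓ, ?_⟩
  rw [Units.val_pow_eq_pow_val]
  exact pow_prime_map_toZModPow_of_map_eq hs hg

/-- Hence every class of `Γ(ℓᵗ)/Γ(ℓ^{t+1})`, `t ≥ s`, meets `G`. [folklore] -/
theorem meets_of_le {G : Subgroup (GL (Fin 2) ℤ_[ℓ])} {s : ℕ} (hs : 2 ≤ s)
    (H : ∀ a : Matrix (Fin 2) (Fin 2) ℤ_[ℓ], ∃ g ∈ G,
      (g : Matrix (Fin 2) (Fin 2) ℤ_[ℓ]).map (PadicInt.toZModPow (s + 1)) =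
        (1 + (ℓ : ℤ_[ℓ]) ^ s • a).map (PadicInt.toZModPow (s + 1)))
    {t : ℕ} (hst : s ≤ t) :
    ∀ a : Matrix (Fin 2) (Fin 2) ℤ_[ℓ], ∃ g ∈ G,
      (g : Matrix (Fin 2) (Fin 2) ℤ_[ℓ]).map (PadicInt.toZModPow (t + 1)) =
        (1 + (ℓ : ℤ_[ℓ]) ^ t • a).map (PadicInt.toZModPow (t + 1)) := by
  induction t, hst using Nat.le_induction with
  | base => exact H
  | succ t hst ih => exact meets_succ (hs.trans hst) ih

/-- Approximation to every depth: for `y ∈ Γ(ℓˢ)` and every `t ≥ s` there is `g ∈ G` with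
`g ≡ y (mod ℓ^{t+1})`. [cite: SerreAbelianLadic1968, Ch. IV §3.4, Lemma 3 (p. IV-23), proof] -/
theorem exists_map_eq_of_meets {G : Subgroup (GL (Fin 2) ℤ_[ℓ])} {s : ℕ} (hs : 2 ≤ s)
    (H : ∀ a : Matrix (Fin 2) (Fin 2) ℤ_[ℓ], ∃ g ∈ G,
      (g : Matrix (Fin 2) (Fin 2) ℤ_[ℓ]).map (PadicInt.toZModPow (s + 1)) =
        (1 + (ℓ : ℤ_[ℓ]) ^ s • a).map (PadicInt.toZModPow (s + 1)))
    {y : GL (Fin 2) ℤ_[ℓ]} (hy : y ∈ GL2.congruenceSubgroup (p := ℓ) s) {t : ℕ} (hst : s ≤ t) :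
    ∃ g ∈ G, Matrix.GeneralLinearGroup.map (PadicInt.toZModPow (t + 1)) g =
      Matrix.GeneralLinearGroup.map (PadicInt.toZModPow (t + 1)) y := by
  induction t, hst using Nat.le_induction with
  | base =>
    obtain ⟨a, ha⟩ := exists_eq_one_add_smul_of_mem hy
    obtain ⟨g, hgG, hg⟩ := H a
    refine ⟨g, hgG, Units.ext ?_⟩
    rw [coe_map_toZModPow, coe_map_toZModPow, hg, ha]
  | succ t hst ih =>
    obtain ⟨g₀, hg₀G, hg₀⟩ := ih
    -- `g₀⁻¹ y ∈ Γ(ℓ^{t+1})`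
    have hmem : g₀⁻¹ * y ∈ GL2.congruenceSubgroup (p := ℓ) (t + 1) := by
      rw [GL2.congruenceSubgroup, MonoidHom.mem_ker, map_mul, map_inv, hg₀, inv_mul_cancel]
    obtain ⟨a, ha⟩ := exists_eq_one_add_smul_of_mem hmem
    obtain ⟨h, hhG, hh⟩ := meets_of_le hs H (hst.trans (Nat.le_succ t)) a
    refine ⟨g₀ * h, G.mul_mem hg₀G hhG, ?_⟩
    have hh' : Matrix.GeneralLinearGroup.map (PadicInt.toZModPow (t + 1 + 1)) h =
        Matrix.GeneralLinearGroup.map (PadicInt.toZModPow (t + 1 + 1)) (g₀⁻¹ * y) := by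
      refine Units.ext ?_
      rw [coe_map_toZModPow, coe_map_toZModPow, hh, ← ha]
    rw [map_mul, hh', ← map_mul, mul_inv_cancel_left]

/-- Entries of congruent units are close: if the reductions modulo `ℓ^t` agree then
`‖g i j − y i j‖ ≤ ℓ^{-t}`. [folklore] -/
theorem norm_sub_le_of_map_eq {t : ℕ} {g y : GL (Fin 2) ℤ_[ℓ]}
    (h : Matrix.GeneralLinearGroup.map (PadicInt.toZModPow t) g =
      Matrix.GeneralLinearGroup.map (PadicInt.toZModPow t) y) (i j : Fin 2) :
    ‖(g : Matrix (Fin 2) (Fin 2) ℤ_[ℓ]) i j - (y : Matrix (Fin 2) (Fin 2) ℤ_[ℓ]) i j‖ ≤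
      (ℓ : ℝ) ^ (-(t : ℤ)) := by
  rw [PadicInt.norm_le_pow_iff_mem_span_pow, Ideal.mem_span_singleton]
  have h' := congrArg (fun u : GL (Fin 2) (ZMod (ℓ ^ t)) ↦ (u : Matrix (Fin 2) (Fin 2) (ZMod (ℓ ^ t)))) h
  simp only [coe_map_toZModPow] at h'
  exact (map_toZModPow_eq_iff t _ _).1 h' i j

/-- A sequence in `ℤ_ℓ` that is congruent to `x` modulo `ℓ^{t+1}` at stage `t` converges to `x`.
[folklore] -/
theorem tendsto_of_norm_sub_le {x : ℕ → ℤ_[ℓ]} {x₀ : ℤ_[ℓ]}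
    (h : ∀ t, ‖x t - x₀‖ ≤ (ℓ : ℝ) ^ (-((t + 1 : ℕ) : ℤ))) : Tendsto x atTop (𝓝 x₀) := by
  rw [tendsto_iff_norm_sub_tendsto_zero]
  have hℓ : (1 : ℝ) < ℓ := by exact_mod_cast (Fact.out : ℓ.Prime).one_lt
  refine squeeze_zero (fun t ↦ norm_nonneg _) h ?_
  have : (fun t : ℕ ↦ (ℓ : ℝ) ^ (-((t + 1 : ℕ) : ℤ))) = fun t : ℕ ↦ ((ℓ : ℝ)⁻¹) ^ (t + 1) := by
    funext t
    rw [_root_.zpow_neg, zpow_natCast, inv_pow]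
  rw [this]
  refine (tendsto_pow_atTop_nhds_zero_of_lt_one (inv_nonneg.2 (by positivity))
    (inv_lt_one_of_one_lt₀ hℓ)).comp (tendsto_add_atTop_nat 1)

/-- **Passage to the limit.**  If `G ≤ GL₂(ℤ_ℓ)` is closed and `y` is congruent to elements
of `G` modulo arbitrarily high powers of `ℓ` (here: modulo `ℓ^{s+t+1}` for every `t`), then
`y ∈ G`: the approximants converge to `y` entrywise together with their inverses, i.e. in the
topology of `GL₂(ℤ_ℓ)`. [cite: SerreAbelianLadic1968, Ch. IV §3.4, Lemma 3 (p. IV-23), proof] -/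
theorem mem_of_isClosed_of_forall_exists_map_eq {G : Subgroup (GL (Fin 2) ℤ_[ℓ])}
    (hG : IsClosed (G : Set (GL (Fin 2) ℤ_[ℓ]))) (s : ℕ) {y : GL (Fin 2) ℤ_[ℓ]}
    (hex : ∀ t : ℕ, ∃ g ∈ G,
      Matrix.GeneralLinearGroup.map (PadicInt.toZModPow (s + t + 1)) g =
        Matrix.GeneralLinearGroup.map (PadicInt.toZModPow (s + t + 1)) y) :
    y ∈ G := by
  choose g hgG hg using hex
  have hℓ : (1 : ℝ) ≤ ℓ := by exact_mod_cast (Fact.out : ℓ.Prime).one_lt.le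
  have hpow : ∀ t : ℕ, (ℓ : ℝ) ^ (-((s + t + 1 : ℕ) : ℤ)) ≤ (ℓ : ℝ) ^ (-((t + 1 : ℕ) : ℤ)) :=
    fun t ↦ zpow_le_zpow_right₀ hℓ (by push_cast; omega)
  -- the matrices converge to `y`
  have hval : Tendsto (fun t ↦ ((g t : GL (Fin 2) ℤ_[ℓ]) : Matrix (Fin 2) (Fin 2) ℤ_[ℓ])) atTop
      (𝓝 (y : Matrix (Fin 2) (Fin 2) ℤ_[ℓ])) := by
    refine tendsto_pi_nhds.2 fun i ↦ tendsto_pi_nhds.2 fun j ↦ ?_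
    exact tendsto_of_norm_sub_le fun t ↦ (norm_sub_le_of_map_eq (hg t) i j).trans (hpow t)
  -- and so do their inverses
  have hinv : Tendsto (fun t ↦ (((g t)⁻¹ : GL (Fin 2) ℤ_[ℓ]) : Matrix (Fin 2) (Fin 2) ℤ_[ℓ]))
      atTop (𝓝 ((y⁻¹ : GL (Fin 2) ℤ_[ℓ]) : Matrix (Fin 2) (Fin 2) ℤ_[ℓ])) := by
    refine tendsto_pi_nhds.2 fun i ↦ tendsto_pi_nhds.2 fun j ↦ ?_
    refine tendsto_of_norm_sub_le fun t ↦ (norm_sub_le_of_map_eq ?_ i j).trans (hpow t)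
    rw [map_inv, map_inv, hg t]
  -- hence `g t → y` in `GL₂(ℤ_ℓ)` (topology induced by `g ↦ (g, g⁻¹)`)
  have htend : Tendsto g atTop (𝓝 y) := by
    rw [Units.isEmbedding_embedProduct.toIsInducing.tendsto_nhds_iff]
    have h2 : Tendsto (fun t ↦ MulOpposite.op (((g t)⁻¹ : GL (Fin 2) ℤ_[ℓ]) :
        Matrix (Fin 2) (Fin 2) ℤ_[ℓ])) atTop
        (𝓝 (MulOpposite.op ((y⁻¹ : GL (Fin 2) ℤ_[ℓ]) : Matrix (Fin 2) (Fin 2) ℤ_[ℓ]))) :=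
      (MulOpposite.continuous_op.tendsto _).comp hinv
    simpa [Function.comp_def] using hval.prodMk_nhds h2
  exact hG.mem_of_tendsto htend (Eventually.of_forall hgG)

/-- **Successive approximation** (Serre).  Let `G ≤ GL₂(ℤ_ℓ)` be a closed subgroup and `s ≥ 2`.
If every class of `Γ(ℓˢ)` modulo `Γ(ℓ^{s+1})` contains an element of `G` — i.e. for every
`a ∈ M₂(ℤ_ℓ)` some `g ∈ G` satisfies `g ≡ 1 + ℓˢ a (mod ℓ^{s+1})` — then `Γ(ℓˢ) ≤ G`.
(Serre states the `SL₂` version from level `1` for `ℓ ≥ 5`; the proof — raise to `ℓ`-th powers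
to climb one level, multiply to correct, pass to the limit using that `G` is closed — is the one
given here, from level `s ≥ 2`, where `(1 + ℓˢ a)^ℓ ≡ 1 + ℓ^{s+1} a (mod ℓ^{s+2})` holds for every
prime `ℓ` including `2`.) [cite: SerreAbelianLadic1968, Ch. IV §3.4, Lemma 3 (p. IV-23), proof] -/
theorem congruenceSubgroup_le_of_isClosed {G : Subgroup (GL (Fin 2) ℤ_[ℓ])}
    (hG : IsClosed (G : Set (GL (Fin 2) ℤ_[ℓ]))) {s : ℕ} (hs : 2 ≤ s)
    (H : ∀ a : Matrix (Fin 2) (Fin 2) ℤ_[ℓ], ∃ g ∈ G,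
      (g : Matrix (Fin 2) (Fin 2) ℤ_[ℓ]).map (PadicInt.toZModPow (s + 1)) =
        (1 + (ℓ : ℤ_[ℓ]) ^ s • a).map (PadicInt.toZModPow (s + 1))) :
    GL2.congruenceSubgroup (p := ℓ) s ≤ G :=
  fun _ hy ↦ mem_of_isClosed_of_forall_exists_map_eq hG s
    fun t ↦ exists_map_eq_of_meets hs H hy (Nat.le_add_right s t)

/-! ### The `SL₂` variant: classes of trace zero, elements of determinant one -/

/-- `Γ(ℓᶜ) ≤ Γ(ℓˢ)` for `s ≤ c`. [folklore] -/
theorem congruenceSubgroup_antitone {s c : ℕ} (hsc : s ≤ c) :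
    GL2.congruenceSubgroup (p := ℓ) c ≤ GL2.congruenceSubgroup (p := ℓ) s := by
  intro g hg
  rw [GL2.mem_congruenceSubgroup_iff] at hg ⊢
  exact fun i j ↦ (pow_dvd_pow _ hsc).trans (hg i j)

/-- `det (1 + ℓᵗ a) = 1 + ℓᵗ tr a + ℓ^{2t} det a` for a `2 × 2` matrix. [folklore] -/
theorem det_one_add_smul (t : ℕ) (a : Matrix (Fin 2) (Fin 2) ℤ_[ℓ]) :
    (1 + (ℓ : ℤ_[ℓ]) ^ t • a).det =
      1 + (ℓ : ℤ_[ℓ]) ^ t * a.trace + (ℓ : ℤ_[ℓ]) ^ t * (ℓ : ℤ_[ℓ]) ^ t * a.det := by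
  simp only [Matrix.det_fin_two, Matrix.trace_fin_two, Matrix.add_apply, Matrix.smul_apply,
    Matrix.one_apply_eq, Matrix.one_apply_ne (by decide : (0 : Fin 2) ≠ 1),
    Matrix.one_apply_ne (by decide : (1 : Fin 2) ≠ 0), smul_eq_mul]
  ring

/-- If `det (1 + ℓᵗ a) = 1` with `t ≥ 1` then `ℓ ∣ tr a`. [folklore] -/
theorem dvd_trace_of_det_one_add_smul_eq_one {t : ℕ} (ht : 1 ≤ t) {a : Matrix (Fin 2) (Fin 2) ℤ_[ℓ]}
    (h : (1 + (ℓ : ℤ_[ℓ]) ^ t • a).det = 1) : (ℓ : ℤ_[ℓ]) ∣ a.trace := by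
  rw [det_one_add_smul, add_assoc, add_eq_left, mul_assoc, ← mul_add, mul_eq_zero] at h
  have hℓ : (ℓ : ℤ_[ℓ]) ^ t ≠ 0 := pow_ne_zero _ (by exact_mod_cast (Fact.out : ℓ.Prime).ne_zero)
  rcases h with h | h
  · exact absurd h hℓ
  · rw [add_eq_zero_iff_eq_neg] at h
    rw [h, ← Nat.sub_add_cancel ht, pow_succ]
    exact ⟨-((ℓ : ℤ_[ℓ]) ^ (t - 1) * a.det), by ring⟩

/-- The determinant-one congruence modulo `ℓ^{s+1}`: if every class `1 + ℓˢ a` with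
`ℓ ∣ tr a` (`s ≥ 2`) contains an element of `G` of determinant `1`, then the same holds one
level up (take `ℓ`-th powers). [cite: SerreAbelianLadic1968, Ch. IV §3.4, Lemma 3 (p. IV-23), proof] -/
theorem sl2_meets_succ {G : Subgroup (GL (Fin 2) ℤ_[ℓ])} {s : ℕ} (hs : 2 ≤ s)
    (H : ∀ a : Matrix (Fin 2) (Fin 2) ℤ_[ℓ], (ℓ : ℤ_[ℓ]) ∣ a.trace → ∃ g ∈ G,
      (g : Matrix (Fin 2) (Fin 2) ℤ_[ℓ]).det = 1 ∧
      (g : Matrix (Fin 2) (Fin 2) ℤ_[ℓ]).map (PadicInt.toZModPow (s + 1)) =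
        (1 + (ℓ : ℤ_[ℓ]) ^ s • a).map (PadicInt.toZModPow (s + 1))) :
    ∀ a : Matrix (Fin 2) (Fin 2) ℤ_[ℓ], (ℓ : ℤ_[ℓ]) ∣ a.trace → ∃ g ∈ G,
      (g : Matrix (Fin 2) (Fin 2) ℤ_[ℓ]).det = 1 ∧
      (g : Matrix (Fin 2) (Fin 2) ℤ_[ℓ]).map (PadicInt.toZModPow (s + 1 + 1)) =
        (1 + (ℓ : ℤ_[ℓ]) ^ (s + 1) • a).map (PadicInt.toZModPow (s + 1 + 1)) := by
  intro a ha
  obtain ⟨g, hgG, hg1, hg⟩ := H a ha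
  refine ⟨g ^ ℓ, G.pow_mem hgG ℓ, ?_, ?_⟩
  · rw [Units.val_pow_eq_pow_val, det_pow, hg1, one_pow]
  · rw [Units.val_pow_eq_pow_val]
    exact pow_prime_map_toZModPow_of_map_eq hs hg

/-- Hence at every level `t ≥ s`. [folklore] -/
theorem sl2_meets_of_le {G : Subgroup (GL (Fin 2) ℤ_[ℓ])} {s : ℕ} (hs : 2 ≤ s)
    (H : ∀ a : Matrix (Fin 2) (Fin 2) ℤ_[ℓ], (ℓ : ℤ_[ℓ]) ∣ a.trace → ∃ g ∈ G,
      (g : Matrix (Fin 2) (Fin 2) ℤ_[ℓ]).det = 1 ∧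
      (g : Matrix (Fin 2) (Fin 2) ℤ_[ℓ]).map (PadicInt.toZModPow (s + 1)) =
        (1 + (ℓ : ℤ_[ℓ]) ^ s • a).map (PadicInt.toZModPow (s + 1)))
    {t : ℕ} (hst : s ≤ t) :
    ∀ a : Matrix (Fin 2) (Fin 2) ℤ_[ℓ], (ℓ : ℤ_[ℓ]) ∣ a.trace → ∃ g ∈ G,
      (g : Matrix (Fin 2) (Fin 2) ℤ_[ℓ]).det = 1 ∧
      (g : Matrix (Fin 2) (Fin 2) ℤ_[ℓ]).map (PadicInt.toZModPow (t + 1)) =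
        (1 + (ℓ : ℤ_[ℓ]) ^ t • a).map (PadicInt.toZModPow (t + 1)) := by
  induction t, hst using Nat.le_induction with
  | base => exact H
  | succ t hst ih => exact sl2_meets_succ (hs.trans hst) ih

/-- The determinant of the inverse of a determinant-one element of `GL₂(ℤ_ℓ)` is `1`.
[folklore] -/
theorem det_coe_inv_eq_one {g : GL (Fin 2) ℤ_[ℓ]} (hg : (g : Matrix (Fin 2) (Fin 2) ℤ_[ℓ]).det = 1) :
    ((g⁻¹ : GL (Fin 2) ℤ_[ℓ]) : Matrix (Fin 2) (Fin 2) ℤ_[ℓ]).det = 1 := by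
  have h := congrArg Matrix.det (Units.inv_mul g)
  rwa [det_mul, hg, mul_one, det_one] at h

/-- Approximation to every depth inside `SL₂`: for `y ∈ Γ(ℓˢ)` of determinant `1` and every
`t ≥ s` there is `g ∈ G` of determinant `1` with `g ≡ y (mod ℓ^{t+1})`.
[cite: SerreAbelianLadic1968, Ch. IV §3.4, Lemma 3 (p. IV-23), proof] -/
theorem exists_map_eq_of_sl2_meets {G : Subgroup (GL (Fin 2) ℤ_[ℓ])} {s : ℕ} (hs : 2 ≤ s)
    (H : ∀ a : Matrix (Fin 2) (Fin 2) ℤ_[ℓ], (ℓ : ℤ_[ℓ]) ∣ a.trace → ∃ g ∈ G,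
      (g : Matrix (Fin 2) (Fin 2) ℤ_[ℓ]).det = 1 ∧
      (g : Matrix (Fin 2) (Fin 2) ℤ_[ℓ]).map (PadicInt.toZModPow (s + 1)) =
        (1 + (ℓ : ℤ_[ℓ]) ^ s • a).map (PadicInt.toZModPow (s + 1)))
    {y : GL (Fin 2) ℤ_[ℓ]} (hy : y ∈ GL2.congruenceSubgroup (p := ℓ) s)
    (hy1 : (y : Matrix (Fin 2) (Fin 2) ℤ_[ℓ]).det = 1) {t : ℕ} (hst : s ≤ t) :
    ∃ g ∈ G, (g : Matrix (Fin 2) (Fin 2) ℤ_[ℓ]).det = 1 ∧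
      Matrix.GeneralLinearGroup.map (PadicInt.toZModPow (t + 1)) g =
        Matrix.GeneralLinearGroup.map (PadicInt.toZModPow (t + 1)) y := by
  induction t, hst using Nat.le_induction with
  | base =>
    obtain ⟨a, ha⟩ := exists_eq_one_add_smul_of_mem hy
    have hta : (ℓ : ℤ_[ℓ]) ∣ a.trace :=
      dvd_trace_of_det_one_add_smul_eq_one (by omega : 1 ≤ s) (by rw [← ha, hy1])
    obtain ⟨g, hgG, hg1, hg⟩ := H a hta
    refine ⟨g, hgG, hg1, Units.ext ?_⟩
    rw [coe_map_toZModPow, coe_map_toZModPow, hg, ha]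
  | succ t hst ih =>
    obtain ⟨g₀, hg₀G, hg₀1, hg₀⟩ := ih
    have hmem : g₀⁻¹ * y ∈ GL2.congruenceSubgroup (p := ℓ) (t + 1) := by
      rw [GL2.congruenceSubgroup, MonoidHom.mem_ker, map_mul, map_inv, hg₀, inv_mul_cancel]
    obtain ⟨a, ha⟩ := exists_eq_one_add_smul_of_mem hmem
    have hdet : ((g₀⁻¹ * y : GL (Fin 2) ℤ_[ℓ]) : Matrix (Fin 2) (Fin 2) ℤ_[ℓ]).det = 1 := by
      rw [Units.val_mul, det_mul, det_coe_inv_eq_one hg₀1, hy1, one_mul]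
    have hta : (ℓ : ℤ_[ℓ]) ∣ a.trace :=
      dvd_trace_of_det_one_add_smul_eq_one (by omega : 1 ≤ t + 1) (by rw [← ha, hdet])
    obtain ⟨h, hhG, hh1, hh⟩ := sl2_meets_of_le hs H (hst.trans (Nat.le_succ t)) a hta
    refine ⟨g₀ * h, G.mul_mem hg₀G hhG, ?_, ?_⟩
    · rw [Units.val_mul, det_mul, hg₀1, hh1, one_mul]
    · have hh' : Matrix.GeneralLinearGroup.map (PadicInt.toZModPow (t + 1 + 1)) h =
          Matrix.GeneralLinearGroup.map (PadicInt.toZModPow (t + 1 + 1)) (g₀⁻¹ * y) := by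
        refine Units.ext ?_
        rw [coe_map_toZModPow, coe_map_toZModPow, hh, ← ha]
      rw [map_mul, hh', ← map_mul, mul_inv_cancel_left]

/-- **Successive approximation in `SL₂`** (Serre, IV-23, Lemma 3, from level `s ≥ 2` and for
every `ℓ`).  Let `G ≤ GL₂(ℤ_ℓ)` be closed.  If every class `1 + ℓˢ a (mod ℓ^{s+1})` with
`ℓ ∣ tr a` contains an element of `G` of determinant `1`, then `G` contains every element of
`Γ(ℓˢ)` of determinant `1`, i.e. `SL₂(ℤ_ℓ) ∩ Γ(ℓˢ) ⊆ G`.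
[cite: SerreAbelianLadic1968, Ch. IV §3.4, Lemma 3 (p. IV-23), proof] -/
theorem mem_of_isClosed_of_sl2_meets {G : Subgroup (GL (Fin 2) ℤ_[ℓ])}
    (hG : IsClosed (G : Set (GL (Fin 2) ℤ_[ℓ]))) {s : ℕ} (hs : 2 ≤ s)
    (H : ∀ a : Matrix (Fin 2) (Fin 2) ℤ_[ℓ], (ℓ : ℤ_[ℓ]) ∣ a.trace → ∃ g ∈ G,
      (g : Matrix (Fin 2) (Fin 2) ℤ_[ℓ]).det = 1 ∧
      (g : Matrix (Fin 2) (Fin 2) ℤ_[ℓ]).map (PadicInt.toZModPow (s + 1)) =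
        (1 + (ℓ : ℤ_[ℓ]) ^ s • a).map (PadicInt.toZModPow (s + 1)))
    {y : GL (Fin 2) ℤ_[ℓ]} (hy : y ∈ GL2.congruenceSubgroup (p := ℓ) s)
    (hy1 : (y : Matrix (Fin 2) (Fin 2) ℤ_[ℓ]).det = 1) : y ∈ G :=
  mem_of_isClosed_of_forall_exists_map_eq hG s fun t ↦
    let ⟨g, hgG, _, hg⟩ := exists_map_eq_of_sl2_meets hs H hy hy1 (Nat.le_add_right s t)
    ⟨g, hgG, hg⟩

/-! ### From `GL₂(ℤ_ℓ)` to `GL₂(ℚ_ℓ)`: principal congruence subgroups are neighbourhoods of `1` -/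

/-- The inclusion `ι : GL₂(ℤ_ℓ) → GL₂(ℚ_ℓ)` on matrices. [folklore] -/
theorem coe_map_coeRingHom (g : GL (Fin 2) ℤ_[ℓ]) :
    ((Matrix.GeneralLinearGroup.map (PadicInt.Coe.ringHom (p := ℓ)) g : GL (Fin 2) ℚ_[ℓ]) :
        Matrix (Fin 2) (Fin 2) ℚ_[ℓ]) =
      (g : Matrix (Fin 2) (Fin 2) ℤ_[ℓ]).map ((↑) : ℤ_[ℓ] → ℚ_[ℓ]) := rfl

/-- The inclusion `ι : GL₂(ℤ_ℓ) → GL₂(ℚ_ℓ)` is continuous. [folklore] -/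
theorem continuous_map_coeRingHom :
    Continuous (Matrix.GeneralLinearGroup.map (PadicInt.Coe.ringHom (p := ℓ)) :
      GL (Fin 2) ℤ_[ℓ] → GL (Fin 2) ℚ_[ℓ]) := by
  refine Continuous.units_map _ ?_
  change Continuous fun M : Matrix (Fin 2) (Fin 2) ℤ_[ℓ] ↦ M.map ((↑) : ℤ_[ℓ] → ℚ_[ℓ])
  exact continuous_id.matrix_map continuous_subtype_val

/-- The box `U_m = {g ∈ GL₂(ℚ_ℓ) | ‖g − 1‖ ≤ ℓ^{-m}}` (entrywise) is a neighbourhood of `1` in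
`GL₂(ℚ_ℓ)` (closed balls of positive radius are open in the ultrametric `ℚ_ℓ`). [folklore] -/
theorem box_mem_nhds_one (m : ℕ) :
    {g : GL (Fin 2) ℚ_[ℓ] | ∀ i j, ‖(g : Matrix (Fin 2) (Fin 2) ℚ_[ℓ]) i j -
        (1 : Matrix (Fin 2) (Fin 2) ℚ_[ℓ]) i j‖ ≤ (ℓ : ℝ) ^ (-(m : ℤ))} ∈ 𝓝 (1 : GL (Fin 2) ℚ_[ℓ]) := by
  have hr : (ℓ : ℝ) ^ (-(m : ℤ)) ≠ 0 :=
    zpow_ne_zero _ (by exact_mod_cast (Fact.out : ℓ.Prime).ne_zero)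
  have hopen : IsOpen {M : Matrix (Fin 2) (Fin 2) ℚ_[ℓ] | ∀ i j,
      ‖M i j - (1 : Matrix (Fin 2) (Fin 2) ℚ_[ℓ]) i j‖ ≤ (ℓ : ℝ) ^ (-(m : ℤ))} := by
    have : {M : Matrix (Fin 2) (Fin 2) ℚ_[ℓ] | ∀ i j,
        ‖M i j - (1 : Matrix (Fin 2) (Fin 2) ℚ_[ℓ]) i j‖ ≤ (ℓ : ℝ) ^ (-(m : ℤ))} =
        ⋂ i, ⋂ j, (fun M : Matrix (Fin 2) (Fin 2) ℚ_[ℓ] ↦ M i j - (1 : Matrix (Fin 2) (Fin 2) ℚ_[ℓ]) i j) ⁻¹'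
          Metric.closedBall 0 ((ℓ : ℝ) ^ (-(m : ℤ))) := by
      ext M
      simp only [Set.mem_setOf_eq, Set.mem_iInter, Set.mem_preimage, mem_closedBall_zero_iff]
    rw [this]
    refine isOpen_iInter_of_finite fun i ↦ isOpen_iInter_of_finite fun j ↦ ?_
    exact (IsUltrametricDist.isOpen_closedBall _ hr).preimage
      ((continuous_id.matrix_elem i j).sub continuous_const)
  refine (hopen.preimage Units.continuous_val).mem_nhds ?_
  intro i j
  simp

/-- **`U_m ⊆ ι(Γ(ℓᵐ))`** for `m ≥ 1`: a matrix `g ∈ GL₂(ℚ_ℓ)` with `‖g − 1‖ ≤ ℓ^{-m}` entrywise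
is integral with `g ≡ 1 (mod ℓᵐ)`, and its determinant is an `ℓ`-adic unit. [folklore] -/
theorem exists_map_eq_of_mem_box {m : ℕ} (hm : 1 ≤ m) {g : GL (Fin 2) ℚ_[ℓ]}
    (hg : ∀ i j, ‖(g : Matrix (Fin 2) (Fin 2) ℚ_[ℓ]) i j -
        (1 : Matrix (Fin 2) (Fin 2) ℚ_[ℓ]) i j‖ ≤ (ℓ : ℝ) ^ (-(m : ℤ))) :
    ∃ u ∈ GL2.congruenceSubgroup (p := ℓ) m,
      Matrix.GeneralLinearGroup.map (PadicInt.Coe.ringHom (p := ℓ)) u = g := by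
  have hℓ : (1 : ℝ) ≤ ℓ := by exact_mod_cast (Fact.out : ℓ.Prime).one_lt.le
  have hone : ∀ i j : Fin 2, ((1 : Matrix (Fin 2) (Fin 2) ℤ_[ℓ]) i j : ℚ_[ℓ]) =
      (1 : Matrix (Fin 2) (Fin 2) ℚ_[ℓ]) i j := by
    intro i j
    by_cases hij : i = j
    · subst hij; simp
    · simp [Matrix.one_apply_ne hij]
  -- the entries are `ℓ`-adic integers
  have hint : ∀ i j, ‖(g : Matrix (Fin 2) (Fin 2) ℚ_[ℓ]) i j‖ ≤ 1 := by
    intro i j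
    have h1 : ‖(1 : Matrix (Fin 2) (Fin 2) ℚ_[ℓ]) i j‖ ≤ 1 := by
      rw [← hone]; exact PadicInt.norm_le_one _
    calc ‖(g : Matrix (Fin 2) (Fin 2) ℚ_[ℓ]) i j‖
        = ‖((g : Matrix (Fin 2) (Fin 2) ℚ_[ℓ]) i j - (1 : Matrix (Fin 2) (Fin 2) ℚ_[ℓ]) i j) +
            (1 : Matrix (Fin 2) (Fin 2) ℚ_[ℓ]) i j‖ := by rw [sub_add_cancel]
      _ ≤ max ‖(g : Matrix (Fin 2) (Fin 2) ℚ_[ℓ]) i j - (1 : Matrix (Fin 2) (Fin 2) ℚ_[ℓ]) i j‖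
            ‖(1 : Matrix (Fin 2) (Fin 2) ℚ_[ℓ]) i j‖ := IsUltrametricDist.norm_add_le_max _ _
      _ ≤ max ((ℓ : ℝ) ^ (-(m : ℤ))) 1 := max_le_max (hg i j) h1
      _ = 1 := max_eq_right (zpow_le_one_of_nonpos₀ hℓ (by omega))
  set A : Matrix (Fin 2) (Fin 2) ℤ_[ℓ] := Matrix.of fun i j ↦ ⟨(g : Matrix (Fin 2) (Fin 2) ℚ_[ℓ]) i j, hint i j⟩
    with hA
  have hAcoe : A.map ((↑) : ℤ_[ℓ] → ℚ_[ℓ]) = (g : Matrix (Fin 2) (Fin 2) ℚ_[ℓ]) := by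
    ext i j
    simp [hA]
  -- `A ≡ 1 (mod ℓ^m)`
  have hA1 : A.map (PadicInt.toZModPow m) = 1 := by
    rw [← Matrix.map_one (PadicInt.toZModPow m) (map_zero _) (map_one _), map_toZModPow_eq_iff]
    intro i j
    rw [← Ideal.mem_span_singleton, ← PadicInt.norm_le_pow_iff_mem_span_pow, PadicInt.norm_def,
      PadicInt.coe_sub, hone]
    simpa [hA] using hg i j
  -- `det A` is a unit
  have hdet : IsUnit A.det := by
    rw [GL2.isUnit_iff_isUnit_toZModPow hm, RingHom.map_det, RingHom.mapMatrix_apply, hA1, det_one]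
    exact isUnit_one
  refine ⟨((Matrix.isUnit_iff_isUnit_det A).2 hdet).unit, ?_, ?_⟩
  · rw [mem_congruenceSubgroup_iff_map_eq, IsUnit.unit_spec, hA1]
  · refine Units.ext ?_
    rw [coe_map_coeRingHom, IsUnit.unit_spec, hAcoe]

/-- **A subgroup of `GL₂(ℚ_ℓ)` containing `ι(Γ(ℓᵐ))` (`m ≥ 1`) is open.** [folklore] -/
theorem isOpen_of_map_congruenceSubgroup_le {S : Subgroup (GL (Fin 2) ℚ_[ℓ])} {m : ℕ} (hm : 1 ≤ m)
    (h : (GL2.congruenceSubgroup (p := ℓ) m).map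
      (Matrix.GeneralLinearGroup.map (PadicInt.Coe.ringHom (p := ℓ))) ≤ S) :
    IsOpen (S : Set (GL (Fin 2) ℚ_[ℓ])) := by
  refine S.isOpen_of_mem_nhds (g := 1) (Filter.mem_of_superset (box_mem_nhds_one m) ?_)
  intro g hg
  obtain ⟨u, hu, rfl⟩ := exists_map_eq_of_mem_box hm hg
  exact h ⟨u, hu, rfl⟩

/-- **Openness from successive approximation.**  Let `S ≤ GL₂(ℚ_ℓ)` be a subgroup whose trace on
`GL₂(ℤ_ℓ)` (preimage under `ι`) is closed, and `s ≥ 2`.  If for every `a ∈ M₂(ℤ_ℓ)` some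
`g ∈ GL₂(ℤ_ℓ)` with `ι g ∈ S` satisfies `g ≡ 1 + ℓˢ a (mod ℓ^{s+1})`, then `S` is open.
[cite: SerreAbelianLadic1968, Ch. IV §3.4, Lemma 3 (p. IV-23), proof] -/
theorem isOpen_of_isClosed_comap {S : Subgroup (GL (Fin 2) ℚ_[ℓ])}
    (hS : IsClosed ((S.comap (Matrix.GeneralLinearGroup.map (PadicInt.Coe.ringHom (p := ℓ))) :
      Subgroup (GL (Fin 2) ℤ_[ℓ])) : Set (GL (Fin 2) ℤ_[ℓ])))
    {s : ℕ} (hs : 2 ≤ s)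
    (H : ∀ a : Matrix (Fin 2) (Fin 2) ℤ_[ℓ], ∃ g : GL (Fin 2) ℤ_[ℓ],
      Matrix.GeneralLinearGroup.map (PadicInt.Coe.ringHom (p := ℓ)) g ∈ S ∧
        (g : Matrix (Fin 2) (Fin 2) ℤ_[ℓ]).map (PadicInt.toZModPow (s + 1)) =
          (1 + (ℓ : ℤ_[ℓ]) ^ s • a).map (PadicInt.toZModPow (s + 1))) :
    IsOpen (S : Set (GL (Fin 2) ℚ_[ℓ])) := by
  refine isOpen_of_map_congruenceSubgroup_le (by omega : 1 ≤ s) (Subgroup.map_le_iff_le_comap.2 ?_)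
  refine congruenceSubgroup_le_of_isClosed hS hs fun a ↦ ?_
  obtain ⟨g, hgS, hg⟩ := H a
  exact ⟨g, hgS, hg⟩

/-! ### The graded structure: products, powers and commutators at one level -/

/-- Products at one level: if `g ≡ 1 + ℓˢ a` and `h ≡ 1 + ℓˢ b (mod ℓ^{s+1})`, `s ≥ 1`, then
`g h ≡ 1 + ℓˢ (a + b) (mod ℓ^{s+1})` — the class map `Γ(ℓˢ)/Γ(ℓ^{s+1}) → M₂(𝔽_ℓ)` is a
homomorphism. [folklore] -/
theorem map_mul_of_map_eq {s : ℕ} (hs : 1 ≤ s) {g h a b : Matrix (Fin 2) (Fin 2) ℤ_[ℓ]}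
    (hg : g.map (PadicInt.toZModPow (s + 1)) = (1 + (ℓ : ℤ_[ℓ]) ^ s • a).map (PadicInt.toZModPow (s + 1)))
    (hh : h.map (PadicInt.toZModPow (s + 1)) = (1 + (ℓ : ℤ_[ℓ]) ^ s • b).map (PadicInt.toZModPow (s + 1))) :
    (g * h).map (PadicInt.toZModPow (s + 1)) =
      (1 + (ℓ : ℤ_[ℓ]) ^ s • (a + b)).map (PadicInt.toZModPow (s + 1)) := by
  have hprod : (1 + (ℓ : ℤ_[ℓ]) ^ s • a) * (1 + (ℓ : ℤ_[ℓ]) ^ s • b) =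
      (1 + (ℓ : ℤ_[ℓ]) ^ s • (a + b)) + (ℓ : ℤ_[ℓ]) ^ (s + s) • (a * b) := by
    simp only [mul_add, add_mul, one_mul, mul_one, smul_mul_assoc, mul_smul_comm, smul_add, smul_smul,
      ← pow_add]
    abel
  rw [Matrix.map_mul, hg, hh, ← Matrix.map_mul, hprod, map_add_smul_pow_eq (by omega)]

/-- Powers at one level: `g ≡ 1 + ℓˢ a (mod ℓ^{s+1})` implies `gᵏ ≡ 1 + ℓˢ (k a)`. [folklore] -/
theorem map_pow_of_map_eq {s : ℕ} (hs : 1 ≤ s) {g a : Matrix (Fin 2) (Fin 2) ℤ_[ℓ]}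
    (hg : g.map (PadicInt.toZModPow (s + 1)) = (1 + (ℓ : ℤ_[ℓ]) ^ s • a).map (PadicInt.toZModPow (s + 1)))
    (k : ℕ) :
    (g ^ k).map (PadicInt.toZModPow (s + 1)) =
      (1 + (ℓ : ℤ_[ℓ]) ^ s • ((k : ℤ_[ℓ]) • a)).map (PadicInt.toZModPow (s + 1)) := by
  induction k with
  | zero => simp
  | succ k ih =>
    rw [pow_succ g k, map_mul_of_map_eq hs ih hg, Nat.cast_succ, add_smul, one_smul]

/-- Changing the representative: if `ℓ ∣ (a − b)` entrywise then
`1 + ℓˢ a ≡ 1 + ℓˢ b (mod ℓ^{s+1})`. [folklore] -/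
theorem map_one_add_smul_eq_of_dvd_sub {s : ℕ} {a b : Matrix (Fin 2) (Fin 2) ℤ_[ℓ]}
    (h : ∀ i j, (ℓ : ℤ_[ℓ]) ∣ a i j - b i j) :
    (1 + (ℓ : ℤ_[ℓ]) ^ s • a).map (PadicInt.toZModPow (s + 1)) =
      (1 + (ℓ : ℤ_[ℓ]) ^ s • b).map (PadicInt.toZModPow (s + 1)) := by
  rw [map_toZModPow_eq_iff]
  intro i j
  obtain ⟨c, hc⟩ := h i j
  refine ⟨c, ?_⟩
  simp only [Matrix.add_apply, Matrix.smul_apply, smul_eq_mul]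
  rw [pow_succ]
  linear_combination (ℓ : ℤ_[ℓ]) ^ s * hc

/-- **Commutators are graded brackets.**  For `g = 1 + ℓᵃ x`, `h = 1 + ℓᵇ y` in `GL₂(ℤ_ℓ)`
with `a, b ≥ 1`: `g h g⁻¹ h⁻¹ ≡ 1 + ℓ^{a+b} (x y − y x) (mod ℓ^{a+b+1})` (the graded Lie ring
of the congruence filtration of `GL₂(ℤ_ℓ)`; Lazard). [folklore] -/
theorem map_commutator_eq {a b : ℕ} (ha : 1 ≤ a) (hb : 1 ≤ b) {g h : GL (Fin 2) ℤ_[ℓ]}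
    {x y : Matrix (Fin 2) (Fin 2) ℤ_[ℓ]}
    (hg : (g : Matrix (Fin 2) (Fin 2) ℤ_[ℓ]) = 1 + (ℓ : ℤ_[ℓ]) ^ a • x)
    (hh : (h : Matrix (Fin 2) (Fin 2) ℤ_[ℓ]) = 1 + (ℓ : ℤ_[ℓ]) ^ b • y) :
    ((g * h * g⁻¹ * h⁻¹ : GL (Fin 2) ℤ_[ℓ]) : Matrix (Fin 2) (Fin 2) ℤ_[ℓ]).map
        (PadicInt.toZModPow (a + b + 1)) =
      (1 + (ℓ : ℤ_[ℓ]) ^ (a + b) • (x * y - y * x)).map (PadicInt.toZModPow (a + b + 1)) := by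
  obtain ⟨a, rfl⟩ : ∃ a', a = a' + 1 := ⟨a - 1, by omega⟩
  obtain ⟨b, rfl⟩ : ∃ b', b = b' + 1 := ⟨b - 1, by omega⟩
  -- `c (h g) = g h` with `c` the commutator
  set c : GL (Fin 2) ℤ_[ℓ] := g * h * g⁻¹ * h⁻¹ with hc
  have hchg : c * (h * g) = g * h := by
    rw [hc]; group
  set L : ℤ_[ℓ] := (ℓ : ℤ_[ℓ]) with hL
  set z : Matrix (Fin 2) (Fin 2) ℤ_[ℓ] := x * y - y * x with hz
  -- the candidate `1 + ℓ^{a+b} [x, y]` satisfies the same equation modulo `ℓ^{a+b+1}`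
  have hkey : (1 + L ^ (a + 1 + (b + 1)) • z) * ((h : Matrix (Fin 2) (Fin 2) ℤ_[ℓ]) * g) =
      (g : Matrix (Fin 2) (Fin 2) ℤ_[ℓ]) * h +
        L ^ (a + b + 3) • (L ^ a • (z * x) + L ^ b • (z * y) + L ^ (a + b + 1) • (z * (y * x))) := by
    have hzdef : x * y = z + y * x := by rw [hz, sub_add_cancel]
    rw [hg, hh]
    simp only [mul_add, add_mul, one_mul, mul_one, smul_mul_assoc, mul_smul_comm, smul_add, smul_smul,
      ← mul_assoc, hzdef]
    module
  -- reduce modulo `ℓ^{a+b+1}` and cancel the unit `h g`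
  have hred : ((c : GL (Fin 2) ℤ_[ℓ]) : Matrix (Fin 2) (Fin 2) ℤ_[ℓ]).map
        (PadicInt.toZModPow (a + 1 + (b + 1) + 1)) *
      ((h * g : GL (Fin 2) ℤ_[ℓ]) : Matrix (Fin 2) (Fin 2) ℤ_[ℓ]).map
        (PadicInt.toZModPow (a + 1 + (b + 1) + 1)) =
      (1 + L ^ (a + 1 + (b + 1)) • z).map (PadicInt.toZModPow (a + 1 + (b + 1) + 1)) *
      ((h * g : GL (Fin 2) ℤ_[ℓ]) : Matrix (Fin 2) (Fin 2) ℤ_[ℓ]).map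
        (PadicInt.toZModPow (a + 1 + (b + 1) + 1)) := by
    rw [← Matrix.map_mul, ← Matrix.map_mul, ← Units.val_mul, hchg, Units.val_mul, Units.val_mul, hkey,
      hL, map_add_smul_pow_eq (by omega)]
  have hu : ((h * g : GL (Fin 2) ℤ_[ℓ]) : Matrix (Fin 2) (Fin 2) ℤ_[ℓ]).map
        (PadicInt.toZModPow (a + 1 + (b + 1) + 1)) =
      ((Matrix.GeneralLinearGroup.map (PadicInt.toZModPow (a + 1 + (b + 1) + 1)) (h * g) :
        GL (Fin 2) (ZMod (ℓ ^ (a + 1 + (b + 1) + 1)))) :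
          Matrix (Fin 2) (Fin 2) (ZMod (ℓ ^ (a + 1 + (b + 1) + 1)))) := rfl
  rw [hu, Units.mul_left_inj] at hred
  exact hred

/-- Commutators have determinant `1`. [folklore] -/
theorem det_commutator_eq_one (g h : GL (Fin 2) ℤ_[ℓ]) :
    ((g * h * g⁻¹ * h⁻¹ : GL (Fin 2) ℤ_[ℓ]) : Matrix (Fin 2) (Fin 2) ℤ_[ℓ]).det = 1 := by
  rw [← Matrix.GeneralLinearGroup.val_det_apply, map_mul, map_mul, map_mul, map_inv, map_inv,
    mul_comm (Matrix.GeneralLinearGroup.det g) (Matrix.GeneralLinearGroup.det h),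
    mul_inv_cancel_right, mul_inv_cancel, Units.val_one]

/-- **Graded bracket, congruence form.**  If `g ≡ 1 + ℓᵃ x (mod ℓ^{a+1})` and
`h ≡ 1 + ℓᵇ y (mod ℓ^{b+1})` (`a, b ≥ 1`) then the commutator `g h g⁻¹ h⁻¹` has determinant
`1` and is `≡ 1 + ℓ^{a+b} (x y − y x) (mod ℓ^{a+b+1})`: the classes hit by a subgroup form a
graded Lie subring of `⊕ₘ M₂(𝔽_ℓ)` (congruence filtration; Lazard). [folklore] -/
theorem map_commutator_eq_of_map_eq {a b : ℕ} (ha : 1 ≤ a) (hb : 1 ≤ b) {g h : GL (Fin 2) ℤ_[ℓ]}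
    {x y : Matrix (Fin 2) (Fin 2) ℤ_[ℓ]}
    (hg : (g : Matrix (Fin 2) (Fin 2) ℤ_[ℓ]).map (PadicInt.toZModPow (a + 1)) =
      (1 + (ℓ : ℤ_[ℓ]) ^ a • x).map (PadicInt.toZModPow (a + 1)))
    (hh : (h : Matrix (Fin 2) (Fin 2) ℤ_[ℓ]).map (PadicInt.toZModPow (b + 1)) =
      (1 + (ℓ : ℤ_[ℓ]) ^ b • y).map (PadicInt.toZModPow (b + 1))) :
    ((g * h * g⁻¹ * h⁻¹ : GL (Fin 2) ℤ_[ℓ]) : Matrix (Fin 2) (Fin 2) ℤ_[ℓ]).map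
        (PadicInt.toZModPow (a + b + 1)) =
      (1 + (ℓ : ℤ_[ℓ]) ^ (a + b) • (x * y - y * x)).map (PadicInt.toZModPow (a + b + 1)) := by
  obtain ⟨e, he⟩ := exists_eq_add_smul_of_map_eq hg
  obtain ⟨e', he'⟩ := exists_eq_add_smul_of_map_eq hh
  have hg' : (g : Matrix (Fin 2) (Fin 2) ℤ_[ℓ]) = 1 + (ℓ : ℤ_[ℓ]) ^ a • (x + (ℓ : ℤ_[ℓ]) • e) := by
    rw [he, smul_add, smul_smul, ← pow_succ, add_assoc]
  have hh' : (h : Matrix (Fin 2) (Fin 2) ℤ_[ℓ]) = 1 + (ℓ : ℤ_[ℓ]) ^ b • (y + (ℓ : ℤ_[ℓ]) • e') := by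
    rw [he', smul_add, smul_smul, ← pow_succ, add_assoc]
  rw [map_commutator_eq ha hb hg' hh']
  refine map_one_add_smul_eq_of_dvd_sub fun i j ↦ ?_
  have : (x + (ℓ : ℤ_[ℓ]) • e) * (y + (ℓ : ℤ_[ℓ]) • e') - (y + (ℓ : ℤ_[ℓ]) • e') * (x + (ℓ : ℤ_[ℓ]) • e) -
      (x * y - y * x) =
      (ℓ : ℤ_[ℓ]) • (x * e' + e * y + (ℓ : ℤ_[ℓ]) • (e * e') - (y * e + e' * x + (ℓ : ℤ_[ℓ]) • (e' * e))) := by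
    simp only [mul_add, add_mul, smul_mul_assoc, mul_smul_comm, smul_add, smul_sub, smul_smul]
    module
  rw [← Matrix.sub_apply, this, Matrix.smul_apply, smul_eq_mul]
  exact dvd_mul_right _ _

/-- **Three classes suffice.**  At a level `s ≥ 1`, if the classes of `1 + ℓˢ E`, `1 + ℓˢ F`,
`1 + ℓˢ H` (`E = e₁₂`, `F = e₂₁`, `H = e₁₁ − e₂₂`) modulo `ℓ^{s+1}` each contain an element of
`G` of determinant `1`, then so does every class `1 + ℓˢ a` with `ℓ ∣ tr a` (the hypothesis of
`mem_of_isClosed_of_sl2_meets`): such classes form a group isomorphic to `𝔰𝔩₂(𝔽_ℓ)`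
(for `ℓ = 2`: the trace-zero matrices), spanned by `E, F, H`. [folklore] -/
theorem sl2_meets_of_three {G : Subgroup (GL (Fin 2) ℤ_[ℓ])} {s : ℕ} (hs : 1 ≤ s)
    (hE : ∃ g ∈ G, (g : Matrix (Fin 2) (Fin 2) ℤ_[ℓ]).det = 1 ∧
      (g : Matrix (Fin 2) (Fin 2) ℤ_[ℓ]).map (PadicInt.toZModPow (s + 1)) =
        (1 + (ℓ : ℤ_[ℓ]) ^ s • (!![0, 1; 0, 0] : Matrix (Fin 2) (Fin 2) ℤ_[ℓ])).map (PadicInt.toZModPow (s + 1)))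
    (hF : ∃ g ∈ G, (g : Matrix (Fin 2) (Fin 2) ℤ_[ℓ]).det = 1 ∧
      (g : Matrix (Fin 2) (Fin 2) ℤ_[ℓ]).map (PadicInt.toZModPow (s + 1)) =
        (1 + (ℓ : ℤ_[ℓ]) ^ s • (!![0, 0; 1, 0] : Matrix (Fin 2) (Fin 2) ℤ_[ℓ])).map (PadicInt.toZModPow (s + 1)))
    (hH : ∃ g ∈ G, (g : Matrix (Fin 2) (Fin 2) ℤ_[ℓ]).det = 1 ∧
      (g : Matrix (Fin 2) (Fin 2) ℤ_[ℓ]).map (PadicInt.toZModPow (s + 1)) =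
        (1 + (ℓ : ℤ_[ℓ]) ^ s • (!![1, 0; 0, -1] : Matrix (Fin 2) (Fin 2) ℤ_[ℓ])).map (PadicInt.toZModPow (s + 1))) :
    ∀ a : Matrix (Fin 2) (Fin 2) ℤ_[ℓ], (ℓ : ℤ_[ℓ]) ∣ a.trace → ∃ g ∈ G,
      (g : Matrix (Fin 2) (Fin 2) ℤ_[ℓ]).det = 1 ∧
      (g : Matrix (Fin 2) (Fin 2) ℤ_[ℓ]).map (PadicInt.toZModPow (s + 1)) =
        (1 + (ℓ : ℤ_[ℓ]) ^ s • a).map (PadicInt.toZModPow (s + 1)) := by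
  intro a ha
  obtain ⟨gE, hgEG, hgE1, hgE⟩ := hE
  obtain ⟨gF, hgFG, hgF1, hgF⟩ := hF
  obtain ⟨gH, hgHG, hgH1, hgH⟩ := hH
  -- natural-number representatives of the entries modulo `ℓ`
  have hrep : ∀ n : ℤ_[ℓ], (ℓ : ℤ_[ℓ]) ∣ (PadicInt.zmodRepr n : ℤ_[ℓ]) - n := by
    intro n
    have h := PadicInt.sub_zmodRepr_mem n
    rw [PadicInt.maximalIdeal_eq_span_p, Ideal.mem_span_singleton] at h
    rw [← dvd_neg, neg_sub]
    exact h
  have htr : (ℓ : ℤ_[ℓ]) ∣ a 0 0 + a 1 1 := by rwa [Matrix.trace_fin_two] at ha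
  set k₁ := PadicInt.zmodRepr (a 0 1) with hk₁
  set k₂ := PadicInt.zmodRepr (a 1 0) with hk₂
  set k₃ := PadicInt.zmodRepr (a 0 0) with hk₃
  refine ⟨gE ^ k₁ * gF ^ k₂ * gH ^ k₃,
    G.mul_mem (G.mul_mem (G.pow_mem hgEG _) (G.pow_mem hgFG _)) (G.pow_mem hgHG _), ?_, ?_⟩
  · simp only [Units.val_mul, Units.val_pow_eq_pow_val, det_mul, det_pow, hgE1, hgF1, hgH1, one_pow,
      mul_one]
  · have h1 := map_pow_of_map_eq hs hgE k₁
    have h2 := map_pow_of_map_eq hs hgF k₂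
    have h3 := map_pow_of_map_eq hs hgH k₃
    rw [← Units.val_pow_eq_pow_val] at h1 h2 h3
    have h12 := map_mul_of_map_eq hs h1 h2
    rw [← Units.val_mul] at h12
    have h123 := map_mul_of_map_eq hs h12 h3
    rw [← Units.val_mul] at h123
    rw [h123]
    -- the combination `k₁ E + k₂ F + k₃ H` is the explicit matrix `(k₃, k₁; k₂, -k₃)`
    have hcomb : (k₁ : ℤ_[ℓ]) • (!![0, 1; 0, 0] : Matrix (Fin 2) (Fin 2) ℤ_[ℓ]) +
        (k₂ : ℤ_[ℓ]) • (!![0, 0; 1, 0] : Matrix (Fin 2) (Fin 2) ℤ_[ℓ]) +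
        (k₃ : ℤ_[ℓ]) • (!![1, 0; 0, -1] : Matrix (Fin 2) (Fin 2) ℤ_[ℓ]) =
        !![(k₃ : ℤ_[ℓ]), (k₁ : ℤ_[ℓ]); (k₂ : ℤ_[ℓ]), -(k₃ : ℤ_[ℓ])] := by
      ext i j
      fin_cases i <;> fin_cases j <;> simp
    rw [hcomb]
    refine map_one_add_smul_eq_of_dvd_sub fun i j ↦ ?_
    fin_cases i <;> fin_cases j
    · simpa using hrep (a 0 0)
    · simpa using hrep (a 0 1)
    · simpa using hrep (a 1 0)
    · have h := (hrep (a 0 0)).add htr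
      have e : -(k₃ : ℤ_[ℓ]) - a 1 1 = -(((k₃ : ℤ_[ℓ]) - a 0 0) + (a 0 0 + a 1 1)) := by ring
      simpa [e] using h.neg_right

/-! ### Combining the `SL₂` part with the determinant -/

/-- The determinant of an element of `Γ(ℓᶜ)` is `≡ 1 (mod ℓᶜ)`. [folklore] -/
theorem pow_dvd_det_sub_one {c : ℕ} {y : GL (Fin 2) ℤ_[ℓ]} (hy : y ∈ GL2.congruenceSubgroup (p := ℓ) c) :
    (ℓ : ℤ_[ℓ]) ^ c ∣ (y : Matrix (Fin 2) (Fin 2) ℤ_[ℓ]).det - 1 := by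
  obtain ⟨a, ha⟩ := exists_eq_one_add_smul_of_mem hy
  rw [ha, det_one_add_smul]
  exact ⟨a.trace + (ℓ : ℤ_[ℓ]) ^ c * a.det, by ring⟩

/-- **`SL₂`-part plus determinants give a full congruence subgroup.**  Let `S ≤ GL₂(ℚ_ℓ)` be a
subgroup, `s ≤ c`.  If `S` contains `ι(y)` for every `y ∈ Γ(ℓˢ)` of determinant `1`, and the
determinants of the elements `y ∈ Γ(ℓˢ)` with `ι(y) ∈ S` cover `1 + ℓᶜ ℤ_ℓ`, then
`ι(Γ(ℓᶜ)) ≤ S`: for `y ∈ Γ(ℓᶜ)` pick `g` with `det g = det y`, then `g⁻¹ y` has determinant `1`.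
[folklore] -/
theorem map_congruenceSubgroup_le_of_sl2_of_det {S : Subgroup (GL (Fin 2) ℚ_[ℓ])} {s c : ℕ}
    (hsc : s ≤ c)
    (h1 : ∀ y ∈ GL2.congruenceSubgroup (p := ℓ) s, (y : Matrix (Fin 2) (Fin 2) ℤ_[ℓ]).det = 1 →
      Matrix.GeneralLinearGroup.map (PadicInt.Coe.ringHom (p := ℓ)) y ∈ S)
    (h2 : ∀ u : ℤ_[ℓ], (ℓ : ℤ_[ℓ]) ^ c ∣ u - 1 → ∃ g ∈ GL2.congruenceSubgroup (p := ℓ) s,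
      Matrix.GeneralLinearGroup.map (PadicInt.Coe.ringHom (p := ℓ)) g ∈ S ∧
        (g : Matrix (Fin 2) (Fin 2) ℤ_[ℓ]).det = u) :
    (GL2.congruenceSubgroup (p := ℓ) c).map
      (Matrix.GeneralLinearGroup.map (PadicInt.Coe.ringHom (p := ℓ))) ≤ S := by
  rintro _ ⟨y, hy, rfl⟩
  obtain ⟨g, hg, hgS, hgdet⟩ := h2 _ (pow_dvd_det_sub_one hy)
  have hmem : g⁻¹ * y ∈ GL2.congruenceSubgroup (p := ℓ) s :=
    Subgroup.mul_mem _ (Subgroup.inv_mem _ hg) (congruenceSubgroup_antitone hsc hy)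
  have hdet : ((g⁻¹ * y : GL (Fin 2) ℤ_[ℓ]) : Matrix (Fin 2) (Fin 2) ℤ_[ℓ]).det = 1 := by
    have h := congrArg Matrix.det (Units.inv_mul g)
    rw [det_mul, det_one, hgdet] at h
    rw [Units.val_mul, det_mul, h]
  have := S.mul_mem hgS (h1 _ hmem hdet)
  rwa [← map_mul, mul_inv_cancel_left] at this

/-- Hence such an `S` is open (`c ≥ 1`). [folklore] -/
theorem isOpen_of_sl2_of_det {S : Subgroup (GL (Fin 2) ℚ_[ℓ])} {s c : ℕ} (hc : 1 ≤ c)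
    (hsc : s ≤ c)
    (h1 : ∀ y ∈ GL2.congruenceSubgroup (p := ℓ) s, (y : Matrix (Fin 2) (Fin 2) ℤ_[ℓ]).det = 1 →
      Matrix.GeneralLinearGroup.map (PadicInt.Coe.ringHom (p := ℓ)) y ∈ S)
    (h2 : ∀ u : ℤ_[ℓ], (ℓ : ℤ_[ℓ]) ^ c ∣ u - 1 → ∃ g ∈ GL2.congruenceSubgroup (p := ℓ) s,
      Matrix.GeneralLinearGroup.map (PadicInt.Coe.ringHom (p := ℓ)) g ∈ S ∧
        (g : Matrix (Fin 2) (Fin 2) ℤ_[ℓ]).det = u) :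
    IsOpen (S : Set (GL (Fin 2) ℚ_[ℓ])) :=
  isOpen_of_map_congruenceSubgroup_le hc (map_congruenceSubgroup_le_of_sl2_of_det hsc h1 h2)

/-! ### The engine tail for a Galois representation -/

/-- **Open image from one full level.**  Let `ρ : Γ_ℚ → GL₂(ℚ_ℓ)` be a continuous representation
and `s ≥ 2`.  If for every `a ∈ M₂(ℤ_ℓ)` the image of `ρ` contains an integral matrix
`g ≡ 1 + ℓˢ a (mod ℓ^{s+1})` — i.e. `ρ(Γ_ℚ) ∩ Γ(ℓˢ)` maps onto `Γ(ℓˢ)/Γ(ℓ^{s+1}) ≅ M₂(𝔽_ℓ)` —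
then `ρ(Γ_ℚ)` is open in `GL₂(ℚ_ℓ)`: the image is compact, so its trace on `GL₂(ℤ_ℓ)` is
closed, and successive approximation gives `ι(Γ(ℓˢ)) ⊆ ρ(Γ_ℚ)`.  This is the last step of every
proof of the open-image theorem `momose_isOpen_range_galoisRep` (Serre; Ribet; Momose); the
Lie-algebra computation producing the full level is not formalised here.
[cite: SerreAbelianLadic1968, Ch. IV §3.4, Lemma 3 (p. IV-23), proof] -/
theorem isOpen_range_of_meets (ρ : GaloisRepresentations.FramedGaloisRep ℚ ℚ_[ℓ] 2) {s : ℕ}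
    (hs : 2 ≤ s)
    (H : ∀ a : Matrix (Fin 2) (Fin 2) ℤ_[ℓ], ∃ g : GL (Fin 2) ℤ_[ℓ],
      Matrix.GeneralLinearGroup.map (PadicInt.Coe.ringHom (p := ℓ)) g ∈ Set.range ⇑ρ ∧
        (g : Matrix (Fin 2) (Fin 2) ℤ_[ℓ]).map (PadicInt.toZModPow (s + 1)) =
          (1 + (ℓ : ℤ_[ℓ]) ^ s • a).map (PadicInt.toZModPow (s + 1))) :
    IsOpen (Set.range ⇑ρ) := by
  have hrange : ((ρ.toMonoidHom.range : Subgroup (GL (Fin 2) ℚ_[ℓ])) : Set (GL (Fin 2) ℚ_[ℓ])) =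
      Set.range ⇑ρ := by
    rw [MonoidHom.coe_range]
    rfl
  rw [← hrange]
  refine isOpen_of_isClosed_comap ?_ hs fun a ↦ ?_
  · rw [Subgroup.coe_comap, hrange]
    exact ((isCompact_range (map_continuous ρ)).isClosed).preimage continuous_map_coeRingHom
  · obtain ⟨g, hg, hga⟩ := H a
    refine ⟨g, ?_, hga⟩
    rw [← SetLike.mem_coe, hrange]
    exact hg

/-- **Open image from the `SL₂`-part at one level and the determinants.**  Let
`ρ : Γ_ℚ → GL₂(ℚ_ℓ)` be continuous, `2 ≤ s ≤ c`.  Suppose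
(1) for every `a ∈ M₂(ℤ_ℓ)` with `ℓ ∣ tr a` the image of `ρ` contains an integral matrix of
determinant `1` congruent to `1 + ℓˢ a (mod ℓ^{s+1})` (e.g. commutators of image elements), and
(2) the determinants of the integral elements `≡ 1 (mod ℓˢ)` of the image cover `1 + ℓᶜ ℤ_ℓ`
(e.g. `det ρ = χ_ℓ^{k−1}` on an open subgroup).  Then `ρ(Γ_ℚ)` is open in `GL₂(ℚ_ℓ)`:
by `SL₂`-successive approximation the image contains `ι(SL₂(ℤ_ℓ) ∩ Γ(ℓˢ))`, and with (2) it
contains `ι(Γ(ℓᶜ))`.  This is the form in which the Lie-algebra computation (`𝔤_ℓ ⊇ 𝔰𝔩₂`,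
Ribet 1977, Thm. (5.7), after Serre) and `det ρ_f = ε χ_ℓ^{k−1}` (`Ribet1977.prop22_det_eq`)
are to be combined for `momose_isOpen_range_galoisRep`.
[cite: SerreAbelianLadic1968, Ch. IV §3.4, Lemma 3 (p. IV-23), proof] -/
theorem isOpen_range_of_sl2_meets_of_det (ρ : GaloisRepresentations.FramedGaloisRep ℚ ℚ_[ℓ] 2)
    {s c : ℕ} (hs : 2 ≤ s) (hsc : s ≤ c)
    (H1 : ∀ a : Matrix (Fin 2) (Fin 2) ℤ_[ℓ], (ℓ : ℤ_[ℓ]) ∣ a.trace → ∃ g : GL (Fin 2) ℤ_[ℓ],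
      Matrix.GeneralLinearGroup.map (PadicInt.Coe.ringHom (p := ℓ)) g ∈ Set.range ⇑ρ ∧
        (g : Matrix (Fin 2) (Fin 2) ℤ_[ℓ]).det = 1 ∧
        (g : Matrix (Fin 2) (Fin 2) ℤ_[ℓ]).map (PadicInt.toZModPow (s + 1)) =
          (1 + (ℓ : ℤ_[ℓ]) ^ s • a).map (PadicInt.toZModPow (s + 1)))
    (H2 : ∀ u : ℤ_[ℓ], (ℓ : ℤ_[ℓ]) ^ c ∣ u - 1 → ∃ g ∈ GL2.congruenceSubgroup (p := ℓ) s,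
      Matrix.GeneralLinearGroup.map (PadicInt.Coe.ringHom (p := ℓ)) g ∈ Set.range ⇑ρ ∧
        (g : Matrix (Fin 2) (Fin 2) ℤ_[ℓ]).det = u) :
    IsOpen (Set.range ⇑ρ) := by
  have hrange : ((ρ.toMonoidHom.range : Subgroup (GL (Fin 2) ℚ_[ℓ])) : Set (GL (Fin 2) ℚ_[ℓ])) =
      Set.range ⇑ρ := by
    rw [MonoidHom.coe_range]
    rfl
  have hmemS : ∀ x, x ∈ ρ.toMonoidHom.range ↔ x ∈ Set.range ⇑ρ := fun x ↦ by
    rw [← SetLike.mem_coe, hrange]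
  rw [← hrange]
  -- the trace of the image on `GL₂(ℤ_ℓ)` is closed
  have hclosed : IsClosed ((ρ.toMonoidHom.range.comap
      (Matrix.GeneralLinearGroup.map (PadicInt.Coe.ringHom (p := ℓ))) :
        Subgroup (GL (Fin 2) ℤ_[ℓ])) : Set (GL (Fin 2) ℤ_[ℓ])) := by
    rw [Subgroup.coe_comap, hrange]
    exact ((isCompact_range (map_continuous ρ)).isClosed).preimage continuous_map_coeRingHom
  refine isOpen_of_sl2_of_det (by omega : 1 ≤ c) hsc (fun y hy hy1 ↦ ?_) (fun u hu ↦ ?_)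
  · refine mem_of_isClosed_of_sl2_meets hclosed hs (fun a ha ↦ ?_) hy hy1
    obtain ⟨g, hg, hg1, hga⟩ := H1 a ha
    exact ⟨g, (hmemS _).2 hg, hg1, hga⟩
  · obtain ⟨g, hg, hgS, hgu⟩ := H2 u hu
    exact ⟨g, hg, (hmemS _).2 hgS, hgu⟩

end OpenImage

end Literature.NumberTheory.EllipticCurves.ModularForms

end
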